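import Literature.NumberTheory.GaloisRepresentations.SerreWeightProofs
import Literature.NumberTheory.GaloisRepresentations.SerreWeightTresRamifieeProofs
import Literature.NumberTheory.GaloisRepresentations.SerreWeightExistenceProofs
import HarnessLib

/-!
# Serre's weight is `2` in the three shapes of Serre 1987, §2.8, Prop. 3

`Proofs` file (theorems only: no definition, no named fact, no `sorry`), topic
`NumberTheory/GaloisRepresentations`, sibling of `SerreWeightProofs` (which proves the wild peu
ramifiée case `serreWeightLocal_eq_two_holds`) and `SerreWeightTresRamifieeProofs`.

J.-P. Serre, *Sur les représentations modulaires de degré 2 de `Gal(ℚ̄/ℚ)`*, Duke Math. J. 54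
(1987), §2.8, Prop. 3 (p. 189): *"Pour que l'invariant `k` de `ρ_p` soit égal à `2`, il faut et il
suffit que `ρ_p|I` soit de l'un des deux types suivants: (2.8.1) `ρ_p|I = diag(ψ', ψ)` où `ψ, ψ'`
sont les deux caractères fondamentaux de niveau `2`; (2.8.2) `ρ_p|I = (χ 0; 0 1)` ou `(χ *; 0 1)`,
l'action du groupe d'inertie sauvage étant, soit triviale, soit peu ramifiée."*  This file proves
the "il suffit" direction for the tree's recipe `ModPGaloisRep.serreWeightLocal` (item C16), in
the three sub-cases, for a non-archimedean local field `F` with `q = #𝓀[F]` (`= p` over `ℚ_p`):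

* `serreWeightLocal_eq_two_of_hasLevelTwoInertiaShape_zero_one` — (2.8.1): if
  `ρ̄|I_F ≃ diag(ψ₂^q, ψ₂)` (`HasLevelTwoInertiaShape ι ϖ hϖ 0 1`) then `k(ρ̄_F) = 2`
  (`2 = 1 + q·0 + 1` is a level-two weight and every level-two weight is `≥ 2`);
* `serreWeightLocal_eq_two_of_isTamelyRamified` — (2.8.2), tame: if `ρ̄_F` is tamely ramified with
  `ρ̄|I_F ≃ (χ *; 0 1)` (`HasLevelOneInertiaShape ι ϖ hϖ 1 0`, `q ≠ 2`) then `k(ρ̄_F) = 2`: no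
  level-two shape has the trivial character on its diagonal
  (`not_isLevelTwoWeight_of_hasLevelOneInertiaShape_one_zero`), `ρ̄|I_F ≃ diag(1, χ)` is the tame
  shape `(a, b) = (0, 1)` of weight `1 + q·0 + 1 = 2`, and every other tame normalisation
  `0 ≤ a ≤ b ≤ q - 2` with `{χ^a, χ^b} = {1, χ}` is `(0, 1)`;
* `serreWeightLocal_eq_two_of_isPeuRamifie` — (2.8.2), wild peu ramifiée: the tree's
  `serreWeightLocal_eq_two_holds`, restated with the injectivity of `ι` discharged (a ring map out
  of the residue field `S ⧸ 𝔓` of `F̄`);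

with global wrappers `serreWeight_eq_two_of_hasLevelTwoInertiaShape_zero_one`,
`serreWeight_eq_two_of_isTamelyRamified`, `serreWeight_eq_two_of_isPeuRamifie` for
`serreWeight p ρ̄ loc ι` at a local restriction datum `loc` (`q = p`).

Tools proved on the way: `diagChar_eq_or_eq_swap` (two triangular forms of one homomorphism into
`GL₂(k)` have the same diagonal characters up to order — characteristic polynomials and "a group is
not the union of two proper subgroups"), `fundamentalCharacter_pow_eq_one_iff` (`ψ_m ^ e = 1 ↔
q^m - 1 ∣ e`, from the surjectivity `exists_fundamentalCharacter_apply_eq` of the Kummer character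
and the injectivity of roots of unity of order prime to `p` modulo `𝔓`).

## References

* [Serre1987] J.-P. Serre, Duke Math. J. 54 (1987), 179–230: §2.1 Prop. 1, §2.2 (2.2.1)–(2.2.4),
  §2.3 (2.3.1)–(2.3.2), §2.4 (ii₁) (2.4.8), §2.8 Prop. 3 ((2.8.1), (2.8.2), p. 189).
* [SerreInventiones1972] J.-P. Serre, Invent. Math. 15 (1972), §1.3 (Prop. 1–2), §1.7.
* [Edixhoven1992] B. Edixhoven, Invent. Math. 109 (1992), §4.3.
-/

noncomputable section

open scoped Valued
open Field ValuativeRel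

namespace Literature.NumberTheory.GaloisRepresentations
namespace ModPGaloisRep

open GaloisRepresentations.IsNonarchimedeanLocalField InertiaShape

universe u v

/-! ### Two triangular forms of one homomorphism have the same diagonal characters -/

section Characters

variable {k : Type v} [Field k] {G : Type*} [Group G]

/-- **Diagonal characters are determined up to order.**  If a homomorphism `f : G → GL₂(k)` is
upper triangular with diagonal characters `(χ₀, χ₁)`, and a conjugate `g ↦ Q (f g) Q⁻¹` of it is
upper triangular with diagonal characters `(η₀, η₁)`, then `(χ₀, χ₁) = (η₀, η₁)` or
`(χ₀, χ₁) = (η₁, η₀)`: for each `g` the two pairs have the same sum and product (trace and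
determinant are conjugation invariant), so agree up to order, and a group is not the union of the
two proper subgroups `{χ₀ = η₀}`, `{χ₀ = η₁}`.  This is the uniqueness of the characters `φ, φ'`
of `I` on `V^{ss}` in Serre's §2.1. [cite: Serre1987, §2.1 (unicité de φ, φ')] -/
theorem diagChar_eq_or_eq_swap (f f' : G →* GL (Fin 2) k)
    (hf : ∀ g, (f g : Matrix (Fin 2) (Fin 2) k) 1 0 = 0)
    (hf' : ∀ g, (f' g : Matrix (Fin 2) (Fin 2) k) 1 0 = 0)
    (Q : GL (Fin 2) k) (hQ : ∀ g, f' g = Q * f g * Q⁻¹) :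
    (diagChar f hf 0 = diagChar f' hf' 0 ∧ diagChar f hf 1 = diagChar f' hf' 1) ∨
      (diagChar f hf 0 = diagChar f' hf' 1 ∧ diagChar f hf 1 = diagChar f' hf' 0) := by
  -- pointwise: same trace and determinant
  have hpt : ∀ g, (diagChar f hf 0 g = diagChar f' hf' 0 g ∧ diagChar f hf 1 g = diagChar f' hf' 1 g) ∨
      (diagChar f hf 0 g = diagChar f' hf' 1 g ∧ diagChar f hf 1 g = diagChar f' hf' 0 g) := by
    intro g
    have htr : Matrix.trace ((f' g : GL (Fin 2) k) : Matrix (Fin 2) (Fin 2) k) =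
        Matrix.trace ((f g : GL (Fin 2) k) : Matrix (Fin 2) (Fin 2) k) := by
      rw [hQ g, Units.val_mul, Units.val_mul, Matrix.trace_mul_cycle, ← Units.val_mul,
        inv_mul_cancel, Units.val_one, Matrix.one_mul]
    have hdet : Matrix.det ((f' g : GL (Fin 2) k) : Matrix (Fin 2) (Fin 2) k) =
        Matrix.det ((f g : GL (Fin 2) k) : Matrix (Fin 2) (Fin 2) k) := by
      rw [hQ g, ← Matrix.GeneralLinearGroup.val_det_apply, map_mul, map_mul, map_inv,
        mul_inv_cancel_comm, Matrix.GeneralLinearGroup.val_det_apply]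
    rw [eq_of_diagChar f hf g, Matrix.trace_fin_two_of] at htr
    rw [eq_of_diagChar f' hf' g, Matrix.trace_fin_two_of] at htr
    rw [eq_of_diagChar f hf g, Matrix.det_fin_two_of] at hdet
    rw [eq_of_diagChar f' hf' g, Matrix.det_fin_two_of] at hdet
    simp only [mul_zero, sub_zero] at hdet
    rcases eq_or_eq_of_add_eq_of_mul_eq htr.symm hdet.symm with ⟨h0, h1⟩ | ⟨h0, h1⟩
    · exact Or.inl ⟨Units.ext h0, Units.ext h1⟩
    · exact Or.inr ⟨Units.ext h0, Units.ext h1⟩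
  -- the two subgroups `{χ₀ = η₀}` and `{χ₀ = η₁}`
  set A : Subgroup G := (diagChar f hf 0 / diagChar f' hf' 0).ker with hA
  set B : Subgroup G := (diagChar f hf 0 / diagChar f' hf' 1).ker with hB
  have hA' : ∀ g, g ∈ A ↔ diagChar f hf 0 g = diagChar f' hf' 0 g := fun g => by
    rw [hA, MonoidHom.mem_ker, MonoidHom.div_apply, div_eq_one]
  have hB' : ∀ g, g ∈ B ↔ diagChar f hf 0 g = diagChar f' hf' 1 g := fun g => by
    rw [hB, MonoidHom.mem_ker, MonoidHom.div_apply, div_eq_one]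
  have hAB : ∀ g, g ∈ A ∨ g ∈ B := fun g =>
    (hpt g).imp (fun h => (hA' g).mpr h.1) (fun h => (hB' g).mpr h.1)
  -- determinants agree, so the second character is determined by the first
  have hprod : ∀ g, diagChar f hf 0 g * diagChar f hf 1 g = diagChar f' hf' 0 g * diagChar f' hf' 1 g := by
    intro g
    rcases hpt g with ⟨h0, h1⟩ | ⟨h0, h1⟩
    · rw [h0, h1]
    · rw [h0, h1, mul_comm]
  rcases eq_top_or_eq_top_of_forall_mem_or hAB with hAt | hBt
  · left
    have h0 : ∀ g, diagChar f hf 0 g = diagChar f' hf' 0 g := fun g => (hA' g).mp (hAt ▸ Subgroup.mem_top g)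
    refine ⟨MonoidHom.ext h0, MonoidHom.ext fun g => ?_⟩
    have := hprod g
    rw [h0 g] at this
    exact mul_left_cancel this
  · right
    have h0 : ∀ g, diagChar f hf 0 g = diagChar f' hf' 1 g := fun g => (hB' g).mp (hBt ▸ Subgroup.mem_top g)
    refine ⟨MonoidHom.ext h0, MonoidHom.ext fun g => ?_⟩
    have := hprod g
    rw [h0 g, mul_comm (diagChar f' hf' 0 g)] at this
    exact mul_left_cancel this

end Characters

/-! ### Orders of the fundamental characters -/

section Fundamental

variable {F : Type u} [Field F] [ValuativeRel F] [TopologicalSpace F] [IsNonarchimedeanLocalField F]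
variable {k : Type v} [Field k]

/-- **`ψ_m` has order exactly `q^m - 1`**: `ψ_m ^ e = 1 ↔ q^m - 1 ∣ e` (`m ≠ 0`, `ι` injective).
`⇐` is `fundamentalCharacter_pow_eq_one`.  `⇒`: the Kummer character takes the value
`ι(ζ mod 𝔓)` at a primitive `(q^m - 1)`-th root of unity `ζ ∈ F̄`
(`exists_fundamentalCharacter_apply_eq`, Serre 1972 §1.3 Prop. 2: `I_t → μ_d` is onto), so
`ζ^e ≡ 1 (mod 𝔓)`, whence `ζ^e = 1` (roots of unity of order prime to `p` are distinct modulo `𝔓`)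
and `q^m - 1 ∣ e`.
[cite: SerreInventiones1972, §1.3 Prop. 2 and §1.7] -/
theorem fundamentalCharacter_pow_eq_one_iff {m : ℕ} (hm : m ≠ 0)
    (ι : absIntegers 𝒪[F] F ⧸ absMaximalIdeal F →+* k) (hι : Function.Injective ι)
    (ϖ : 𝒪[F]) (hϖ : Irreducible ϖ) (e : ℕ) :
    fundamentalCharacter F m ι ϖ hϖ ^ e = 1 ↔ residueFieldCard F ^ m - 1 ∣ e := by
  set N : ℕ := residueFieldCard F ^ m - 1 with hN
  have hNpos : 0 < N := residueFieldCard_pow_sub_one_pos F hm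
  constructor
  · intro h
    haveI : NeZero ((N : ℕ) : AlgebraicClosure F) := ⟨by
      have hu := (isUnit_natCast_residueFieldCard_pow_sub_one F hm).map
        (algebraMap 𝒪[F] (AlgebraicClosure F))
      rw [map_natCast] at hu
      exact hu.ne_zero⟩
    obtain ⟨ζ, hζ⟩ := HasEnoughRootsOfUnity.exists_primitiveRoot (AlgebraicClosure F) N
    obtain ⟨τ, Z, hZ, hτ⟩ := exists_fundamentalCharacter_apply_eq F hm ι ϖ hϖ ζ hζ.pow_eq_one
    have hZN : Z ^ N = 1 := Subtype.ext (by simp [hZ, hζ.pow_eq_one])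
    -- `ι (Z^e mod 𝔓) = ψ(τ)^e = 1`
    have h1 : ι (Ideal.Quotient.mk _ Z ^ e) = 1 := by
      have := congrArg (fun χ : ↥(absInertia F) →* kˣ => ((χ τ : kˣ) : k)) h
      simp only [MonoidHom.pow_apply, Units.val_pow_eq_pow_val, MonoidHom.one_apply,
        Units.val_one] at this
      rw [hτ, ← map_pow] at this
      exact this
    have h2 : Ideal.Quotient.mk (absMaximalIdeal F) Z ^ e = 1 := hι (by rw [h1, map_one])
    have hmem : Z ^ e - 1 ∈ absMaximalIdeal F := by
      rw [← Ideal.Quotient.eq, map_pow, map_one]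
      exact h2
    have hZe : Z ^ e = 1 :=
      eq_one_of_pow_eq_one_of_sub_one_mem_absMaximalIdeal
        (isUnit_natCast_residueFieldCard_pow_sub_one F hm)
        (by rw [← pow_mul, mul_comm, pow_mul, hZN, one_pow]) hmem
    have hζe : ζ ^ e = 1 := by
      have := congrArg (fun y : absIntegers 𝒪[F] F => (y : AlgebraicClosure F)) hZe
      simpa [hZ] using this
    exact hζ.dvd_of_pow_eq_one _ hζe
  · rintro ⟨c, rfl⟩
    have h1 := fundamentalCharacter_pow_eq_one hm ι ϖ hϖ
    ext σ : 1
    have h1σ : fundamentalCharacter F m ι ϖ hϖ σ ^ N = 1 := by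
      have := congrArg (fun χ : ↥(absInertia F) →* kˣ => χ σ) h1
      simpa only [MonoidHom.pow_apply, MonoidHom.one_apply] using this
    rw [MonoidHom.pow_apply, MonoidHom.one_apply, pow_mul, h1σ, one_pow]

/-- `ψ_1 ^ e = 1 ↔ q - 1 ∣ e` (`ι` injective). [cite: SerreInventiones1972, §1.3 Prop. 2 and §1.8] -/
theorem fundamentalCharacter_one_pow_eq_one_iff
    (ι : absIntegers 𝒪[F] F ⧸ absMaximalIdeal F →+* k) (hι : Function.Injective ι)
    (ϖ : 𝒪[F]) (hϖ : Irreducible ϖ) (e : ℕ) :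
    fundamentalCharacter F 1 ι ϖ hϖ ^ e = 1 ↔ residueFieldCard F - 1 ∣ e := by
  rw [fundamentalCharacter_pow_eq_one_iff one_ne_zero ι hι ϖ hϖ e, pow_one]

/-- `ψ_1 ≠ 1` when `q ≠ 2` (`ι` injective). [cite: SerreInventiones1972, §1.8] -/
theorem fundamentalCharacter_one_ne_one
    (ι : absIntegers 𝒪[F] F ⧸ absMaximalIdeal F →+* k) (hι : Function.Injective ι)
    (ϖ : 𝒪[F]) (hϖ : Irreducible ϖ) (hq : residueFieldCard F ≠ 2) :
    fundamentalCharacter F 1 ι ϖ hϖ ≠ 1 := by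
  intro h
  have h1 : fundamentalCharacter F 1 ι ϖ hϖ ^ 1 = 1 := by rw [pow_one, h]
  rw [fundamentalCharacter_one_pow_eq_one_iff ι hι ϖ hϖ 1] at h1
  have h2 := one_lt_residueFieldCard F
  have h3 := Nat.le_of_dvd one_pos h1
  omega

/-- A ring homomorphism out of the residue field `S ⧸ 𝔓` of `F̄` (a field:
`absMaximalIdeal.isMaximal`) into a field is injective. [folklore] -/
theorem residueEmbedding_injective (ι : absIntegers 𝒪[F] F ⧸ absMaximalIdeal F →+* k) :
    Function.Injective ι := by
  letI : Field (absIntegers 𝒪[F] F ⧸ absMaximalIdeal F) := Ideal.Quotient.field _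
  exact ι.injective

end Fundamental

/-! ### The three shapes of weight two -/

section SerreWeightLocal

variable {F : Type u} [Field F] [ValuativeRel F] [TopologicalSpace F] [IsNonarchimedeanLocalField F]
variable {k : Type v} [Field k] [TopologicalSpace k]
variable (ρ : ModPGaloisRep F k 2) (ι : absIntegers 𝒪[F] F ⧸ absMaximalIdeal F →+* k)

/-- **(2.8.1): level two, `k = 2`.**  If `ρ̄|I_F ≃ diag(ψ₂^q, ψ₂)` (the level-two shape with
`(a, b) = (0, 1)`) then `k(ρ̄_F) = 2`: `2 = 1 + q·0 + 1` is a level-two weight, so the recipe is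
in its first case, and every level-two weight `1 + q a + b` (`a < b`) is `≥ 2`
(`two_le_of_isLevelTwoWeight`).  Serre: "la plus petite valeur possible de `k` est `k = 2`, qui
correspond à `a = 0`, `b = 1`, i.e. au cas où `{φ, φ'}` = `{ψ, ψ'}`".
[cite: Serre1987, §2.2 (2.2.3)–(2.2.4) and Remarque (1); §2.8 Prop. 3 (2.8.1)] -/
theorem serreWeightLocal_eq_two_of_hasLevelTwoInertiaShape_zero_one {ϖ : 𝒪[F]} (hϖ : Irreducible ϖ)
    (h : ρ.HasLevelTwoInertiaShape ι ϖ hϖ 0 1) :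
    ρ.serreWeightLocal ι = 2 := by
  classical
  have hq := one_lt_residueFieldCard F
  have h2 : ρ.IsLevelTwoWeight ι 2 :=
    ⟨0, 1, zero_lt_one, by omega, ⟨ϖ, hϖ, h⟩, by ring⟩
  unfold serreWeightLocal
  rw [if_pos ⟨2, h2⟩]
  exact le_antisymm (Nat.sInf_le h2) (le_csInf ⟨2, h2⟩ fun m hm => two_le_of_isLevelTwoWeight hm)

variable {ρ ι}

/-- **A level-two shape has no trivial diagonal character; hence no `ρ̄` with
`ρ̄|I_F ≃ (χ *; 0 1)` has a level-two weight** (`ι` injective).  If also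
`ρ̄|I_F ≃ diag(ψ₂^{a+qb}, ψ₂^{qa+b})` with `0 ≤ a < b ≤ q - 1`, then (`diagChar_eq_or_eq_swap`) one of
`ψ₂^{a+qb}`, `ψ₂^{qa+b}` is the trivial character of `I_F`, so `q² - 1` divides `a + qb` or
`qa + b` (`fundamentalCharacter_pow_eq_one_iff`), both of which lie in `[1, q² - 2]` — absurd.
(Serre: level-two characters have `a ≠ b`, level one is `ψ₂^{(q+1)c}`.)
[cite: Serre1987, §2.1 Prop. 1 and §2.2 (2.2.1)–(2.2.2)] -/
theorem not_isLevelTwoWeight_of_hasLevelOneInertiaShape_one_zero (hι : Function.Injective ι)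
    {ϖ : 𝒪[F]} (hϖ : Irreducible ϖ) (h : ρ.HasLevelOneInertiaShape ι ϖ hϖ 1 0) (m : ℕ) :
    ¬ ρ.IsLevelTwoWeight ι m := by
  rintro ⟨a, b, hab, hbq, ⟨ϖ', hϖ', Q, hQ⟩, -⟩
  obtain ⟨P, hP⟩ := h
  set q := residueFieldCard F with hqdef
  have hq1 : 1 < q := one_lt_residueFieldCard F
  -- the two triangular forms of `ρ̄|I_F`
  have hf : ∀ σ, (conjRestrict ρ P σ : Matrix (Fin 2) (Fin 2) k) 1 0 = 0 := by
    intro σ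
    obtain ⟨c, hc⟩ := hP σ
    rw [conjRestrict_apply, hc]
    rfl
  have hf' : ∀ σ, (conjRestrict ρ Q σ : Matrix (Fin 2) (Fin 2) k) 1 0 = 0 := by
    intro σ
    rw [conjRestrict_apply, hQ σ]
    rfl
  have hconj : ∀ σ, conjRestrict ρ Q σ = (Q * P⁻¹) * conjRestrict ρ P σ * (Q * P⁻¹)⁻¹ := by
    intro σ
    rw [conjRestrict_apply, conjRestrict_apply, mul_inv_rev, inv_inv]
    group
  -- their diagonal characters
  have hd0 : ∀ σ, diagChar (conjRestrict ρ P) hf 1 σ = 1 := by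
    intro σ
    obtain ⟨c, hc⟩ := hP σ
    ext
    rw [coe_diagChar_apply, conjRestrict_apply, hc]
    simp
  have he0 : ∀ σ, diagChar (conjRestrict ρ Q) hf' 0 σ =
      fundamentalCharacter F 2 ι ϖ' hϖ' σ ^ (a + q * b) := by
    intro σ
    ext
    rw [coe_diagChar_apply, conjRestrict_apply, hQ σ]
    simp [hqdef]
  have he1 : ∀ σ, diagChar (conjRestrict ρ Q) hf' 1 σ =
      fundamentalCharacter F 2 ι ϖ' hϖ' σ ^ (q * a + b) := by
    intro σ
    ext
    rw [coe_diagChar_apply, conjRestrict_apply, hQ σ]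
    simp [hqdef]
  -- one of the level-two exponents gives the trivial character
  have hN : residueFieldCard F ^ 2 - 1 = q ^ 2 - 1 := by rw [hqdef]
  have key : q ^ 2 - 1 ∣ a + q * b ∨ q ^ 2 - 1 ∣ q * a + b := by
    rcases diagChar_eq_or_eq_swap (conjRestrict ρ P) (conjRestrict ρ Q) hf hf' (Q * P⁻¹) hconj with
      ⟨-, h1⟩ | ⟨-, h1⟩
    · right
      rw [← hN, ← fundamentalCharacter_pow_eq_one_iff two_ne_zero ι hι ϖ' hϖ']
      ext σ : 1
      rw [MonoidHom.pow_apply, ← he1 σ, ← h1, hd0 σ, MonoidHom.one_apply]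
    · left
      rw [← hN, ← fundamentalCharacter_pow_eq_one_iff two_ne_zero ι hι ϖ' hϖ']
      ext σ : 1
      rw [MonoidHom.pow_apply, ← he0 σ, ← h1, hd0 σ, MonoidHom.one_apply]
  -- but both exponents lie strictly between `0` and `q² - 1`
  have hb1 : 1 ≤ b := by omega
  rcases key with hk | hk
  · have hpos : 0 < a + q * b := by nlinarith
    have hle : q ^ 2 - 1 ≤ a + q * b := Nat.le_of_dvd hpos hk
    have hlt : a + q * b + 2 ≤ q ^ 2 := by nlinarith
    omega
  · have hpos : 0 < q * a + b := by omega
    have hle : q ^ 2 - 1 ≤ q * a + b := Nat.le_of_dvd hpos hk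
    have hlt : q * a + b + 2 ≤ q ^ 2 := by nlinarith
    omega

variable (ρ ι)

/-- **(2.8.2), tame: `ρ̄|I_F = (χ 0; 0 1)` gives `k = 2`** (`q ≠ 2`).  Let `ρ̄_F` be tamely
ramified with `ρ̄|I_F ≃ (χ *; 0 1)` (`HasLevelOneInertiaShape ι ϖ hϖ 1 0`).  Then `k(ρ̄_F) = 2`:
* the level-two case does not occur (`not_isLevelTwoWeight_of_hasLevelOneInertiaShape_one_zero`);
* `ρ̄|I_F` is diagonalisable (`exists_conj_diagonal_of_isTamelyRamified`, the image of `I_F` being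
  cyclic of order prime to `p`, `absInertia_map_isCyclic_holds`) with diagonal characters `{χ, 1}`
  (`diagChar_eq_or_eq_swap`), so — after a swap of the basis if necessary — `ρ̄|I_F ≃ diag(1, χ)`,
  the tame shape `(a, b) = (0, 1)`, of weight `1 + q·0 + 1 = 2` ((2.3.2) with `(a, b) ≠ (0, 0)`);
* any tame normalisation `0 ≤ a ≤ b ≤ q - 2` with `{χ^a, χ^b} = {1, χ}` is `(0, 1)`, `χ` having order
  `q - 1` (`fundamentalCharacter_one_pow_eq_one_iff`), so every tame weight equals `2`.
Serre: "(2.8.2) `ρ_p|I = (χ 0; 0 1)` … l'action de l'inertie sauvage étant triviale" has `k = 2`;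
(2.3.2) `k = 1 + pa + b` with `a = 0`, `b = 1`.
[cite: Serre1987, §2.3 (2.3.1)–(2.3.2); §2.8 Prop. 3 (2.8.2), p. 189] -/
theorem serreWeightLocal_eq_two_of_isTamelyRamified [DiscreteTopology k]
    (hq : residueFieldCard F ≠ 2) (ht : ρ.IsTamelyRamified)
    {ϖ : 𝒪[F]} (hϖ : Irreducible ϖ) (h : ρ.HasLevelOneInertiaShape ι ϖ hϖ 1 0) :
    ρ.serreWeightLocal ι = 2 := by
  classical
  have hι : Function.Injective ι := residueEmbedding_injective ι
  set q := residueFieldCard F with hqdef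
  have hq1 : 1 < q := one_lt_residueFieldCard F
  set χ := fundamentalCharacter F 1 ι ϖ hϖ with hχ
  -- no level-two weight
  have h2 : ¬ ∃ m, ρ.IsLevelTwoWeight ι m := fun ⟨m, hm⟩ =>
    not_isLevelTwoWeight_of_hasLevelOneInertiaShape_one_zero hι hϖ h m hm
  -- the triangular form `(χ *; 0 1)`
  obtain ⟨P, hP⟩ := h
  have hf : ∀ σ, (conjRestrict ρ P σ : Matrix (Fin 2) (Fin 2) k) 1 0 = 0 := by
    intro σ
    obtain ⟨c, hc⟩ := hP σ
    rw [conjRestrict_apply, hc]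
    rfl
  have hdP0 : ∀ σ, diagChar (conjRestrict ρ P) hf 0 σ = χ σ := by
    intro σ
    obtain ⟨c, hc⟩ := hP σ
    ext
    rw [coe_diagChar_apply, conjRestrict_apply, hc]
    simp [hχ]
  have hdP1 : ∀ σ, diagChar (conjRestrict ρ P) hf 1 σ = 1 := by
    intro σ
    obtain ⟨c, hc⟩ := hP σ
    ext
    rw [coe_diagChar_apply, conjRestrict_apply, hc]
    simp
  -- a diagonal form
  obtain ⟨D, hD⟩ := exists_conj_diagonal_of_isTamelyRamified
    (absInertia_map_isCyclic_holds (F := F) (GL (Fin 2) k)) ρ ι ht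
  have hg : ∀ σ, (conjRestrict ρ D σ : Matrix (Fin 2) (Fin 2) k) 1 0 = 0 := fun σ => (hD σ).1
  have hg01 : ∀ σ, (conjRestrict ρ D σ : Matrix (Fin 2) (Fin 2) k) 0 1 = 0 := fun σ => (hD σ).2
  have hdiag : ∀ σ, (conjRestrict ρ D σ : Matrix (Fin 2) (Fin 2) k) =
      !![(diagChar (conjRestrict ρ D) hg 0 σ : k), 0; 0, (diagChar (conjRestrict ρ D) hg 1 σ : k)] := by
    intro σ
    rw [eq_of_diagChar (conjRestrict ρ D) hg σ, hg01 σ]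
  have hconj : ∀ σ, conjRestrict ρ D σ = (D * P⁻¹) * conjRestrict ρ P σ * (D * P⁻¹)⁻¹ := by
    intro σ
    rw [conjRestrict_apply, conjRestrict_apply, mul_inv_rev, inv_inv]
    group
  -- the tame shape `(0, 1)`: `ρ̄|I_F ≃ diag(1, χ)` in a suitable basis
  have hshape : ρ.HasLevelOneInertiaShape ι ϖ hϖ 0 1 := by
    rcases diagChar_eq_or_eq_swap (conjRestrict ρ P) (conjRestrict ρ D) hf hg (D * P⁻¹) hconj with
      ⟨h0, h1⟩ | ⟨h0, h1⟩
    · -- `diag(χ, 1)`: swap the basis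
      refine ⟨swapGL * D, fun σ => ⟨0, ?_⟩⟩
      have hmat : ((swapGL * D * ρ (σ : absoluteGaloisGroup F) * (swapGL * D)⁻¹ : GL (Fin 2) k) :
          Matrix (Fin 2) (Fin 2) k) =
          ((swapGL : GL (Fin 2) k) : Matrix (Fin 2) (Fin 2) k) *
            (conjRestrict ρ D σ : Matrix (Fin 2) (Fin 2) k) *
            (((swapGL : GL (Fin 2) k)⁻¹ : GL (Fin 2) k) : Matrix (Fin 2) (Fin 2) k) := by
        rw [conjRestrict_apply, mul_inv_rev, ← Units.val_mul, ← Units.val_mul]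
        congr 1
        group
      rw [hmat, hdiag σ, swapGL_conj_diag, ← h0, ← h1, hdP0, hdP1]
      simp [hχ]
    · -- already `diag(1, χ)`
      refine ⟨D, fun σ => ⟨0, ?_⟩⟩
      rw [← conjRestrict_apply, hdiag σ, ← h0, ← h1, hdP0, hdP1]
      simp [hχ]
  -- `2` is a tame weight
  have hmem : ρ.IsLevelOneTameWeight ι 2 := by
    refine ⟨ht, 0, 1, zero_le_one, by omega, ⟨ϖ, hϖ, hshape⟩, ?_⟩
    rw [if_neg (by omega)]
    ring
  -- every tame weight is `2`
  have hall : ∀ m ∈ {m | ρ.IsLevelOneTameWeight ι m}, 2 ≤ m := by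
    rintro m ⟨-, a, b, hab, hbq, ⟨ϖ', hϖ', R, hR⟩, rfl⟩
    have hχ' : fundamentalCharacter F 1 ι ϖ' hϖ' = χ := fundamentalCharacter_eq_holds F 1 ι ϖ' ϖ hϖ' hϖ
    have hr : ∀ σ, (conjRestrict ρ R σ : Matrix (Fin 2) (Fin 2) k) 1 0 = 0 := by
      intro σ
      obtain ⟨c, hc⟩ := hR σ
      rw [conjRestrict_apply, hc]
      rfl
    have hdR0 : ∀ σ, diagChar (conjRestrict ρ R) hr 0 σ = χ σ ^ a := by
      intro σ
      obtain ⟨c, hc⟩ := hR σ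
      ext
      rw [coe_diagChar_apply, conjRestrict_apply, hc, hχ']
      simp
    have hdR1 : ∀ σ, diagChar (conjRestrict ρ R) hr 1 σ = χ σ ^ b := by
      intro σ
      obtain ⟨c, hc⟩ := hR σ
      ext
      rw [coe_diagChar_apply, conjRestrict_apply, hc, hχ']
      simp
    have hconjR : ∀ σ, conjRestrict ρ R σ = (R * P⁻¹) * conjRestrict ρ P σ * (R * P⁻¹)⁻¹ := by
      intro σ
      rw [conjRestrict_apply, conjRestrict_apply, mul_inv_rev, inv_inv]
      group
    have hord : ∀ e, χ ^ e = 1 ↔ q - 1 ∣ e := fun e =>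
      fundamentalCharacter_one_pow_eq_one_iff ι hι ϖ hϖ e
    -- `{χ^a, χ^b} = {χ, 1}`
    rcases diagChar_eq_or_eq_swap (conjRestrict ρ P) (conjRestrict ρ R) hf hr (R * P⁻¹) hconjR with
      ⟨h0, h1⟩ | ⟨h0, h1⟩
    · -- `χ^a = χ`, `χ^b = 1`: then `b = 0`, `a = 0`, `χ = 1`: impossible for `q ≠ 2`
      exfalso
      have hb : χ ^ b = 1 := by
        ext σ : 1
        rw [MonoidHom.pow_apply, ← hdR1 σ, ← h1, hdP1 σ, MonoidHom.one_apply]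
      have hb0 : b = 0 := by
        rcases Nat.eq_zero_or_pos b with hb0 | hbpos
        · exact hb0
        · exact absurd (Nat.le_of_dvd hbpos ((hord b).mp hb)) (by omega)
      have ha0 : a = 0 := by omega
      have hχ1 : χ = 1 := by
        ext σ : 1
        have := hdR0 σ
        rw [ha0, pow_zero] at this
        rw [← hdP0 σ, h0, this, MonoidHom.one_apply]
      exact fundamentalCharacter_one_ne_one ι hι ϖ hϖ hq hχ1
    · -- `χ^a = 1`, `χ^b = χ`: then `a = 0`, `b = 1`
      have ha : χ ^ a = 1 := by
        ext σ : 1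
        rw [MonoidHom.pow_apply, ← hdR0 σ, ← h1, hdP1 σ, MonoidHom.one_apply]
      have ha0 : a = 0 := by
        rcases Nat.eq_zero_or_pos a with ha0 | hapos
        · exact ha0
        · exact absurd (Nat.le_of_dvd hapos ((hord a).mp ha)) (by omega)
      subst ha0
      rcases Nat.eq_zero_or_pos b with hb0 | hbpos
      · subst hb0
        rw [if_pos ⟨rfl, rfl⟩]
        omega
      · rw [if_neg (by omega)]
        omega
  unfold serreWeightLocal
  rw [if_neg h2, if_pos ht]
  exact le_antisymm (Nat.sInf_le hmem) (le_csInf ⟨2, hmem⟩ hall)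

/-- **(2.8.2), wild peu ramifiée: `ρ̄|I_F = (χ *; 0 1)` peu ramifiée gives `k = 2`.**  The tree's
`serreWeightLocal_eq_two_holds` (`SerreWeightProofs`) with the injectivity of the residue embedding
discharged (`residueEmbedding_injective`).
[cite: Serre1987, §2.4 (ii₁) (2.4.8); §2.8 Prop. 3 (2.8.2), p. 189] -/
theorem serreWeightLocal_eq_two_of_isPeuRamifie [DiscreteTopology k]
    (hw : ¬ ρ.IsTamelyRamified) (hpeu : ρ.IsPeuRamifie)
    {ϖ : 𝒪[F]} (hϖ : Irreducible ϖ) (h : ρ.HasLevelOneInertiaShape ι ϖ hϖ 1 0) :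
    ρ.serreWeightLocal ι = 2 :=
  serreWeightLocal_eq_two_holds ρ ι (residueEmbedding_injective ι) hw hpeu hϖ h

/-- **Serre 1987, §2.8 Prop. 3, "il suffit"** (the three shapes of weight two, `q ≠ 2`):
`k(ρ̄_F) = 2` as soon as `ρ̄|I_F ≃ diag(ψ₂^q, ψ₂)` (2.8.1), or `ρ̄|I_F ≃ (χ *; 0 1)` with `ρ̄_F`
tame or peu ramifiée (2.8.2). [cite: Serre1987, §2.8 Prop. 3, p. 189] -/
theorem serreWeightLocal_eq_two_of_shape [DiscreteTopology k] (hq : residueFieldCard F ≠ 2)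
    {ϖ : 𝒪[F]} (hϖ : Irreducible ϖ)
    (h : ρ.HasLevelTwoInertiaShape ι ϖ hϖ 0 1 ∨
      (ρ.HasLevelOneInertiaShape ι ϖ hϖ 1 0 ∧ (ρ.IsTamelyRamified ∨ ρ.IsPeuRamifie))) :
    ρ.serreWeightLocal ι = 2 := by
  rcases h with h | ⟨h, ht | hpeu⟩
  · exact serreWeightLocal_eq_two_of_hasLevelTwoInertiaShape_zero_one ρ ι hϖ h
  · exact serreWeightLocal_eq_two_of_isTamelyRamified ρ ι hq ht hϖ h
  · by_cases ht : ρ.IsTamelyRamified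
    · exact serreWeightLocal_eq_two_of_isTamelyRamified ρ ι hq ht hϖ h
    · exact serreWeightLocal_eq_two_of_isPeuRamifie ρ ι ht hpeu hϖ h

end SerreWeightLocal

/-! ### The global weight at a local restriction datum -/

section Global

variable {k : Type v} [Field k] [TopologicalSpace k]
variable {p : ℕ} {ρ : ModPGaloisRep ℚ k 2} (loc : LocalRestrictionAt p ρ)
  (ι : absIntegers 𝒪[loc.F] loc.F ⧸ absMaximalIdeal loc.F →+* k)

/-- **`k(ρ̄) = 2` in the level-two case (2.8.1)** at a local restriction datum `loc` (`F ≅ ℚ_p`,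
uniformiser `p`): `ρ̄|I_p ≃ diag(ψ'ₚ, ψₚ)` gives `serreWeight p ρ̄ loc ι = 2`.
[cite: Serre1987, §2.8 Prop. 3 (2.8.1)] -/
theorem serreWeight_eq_two_of_hasLevelTwoInertiaShape_zero_one
    (h : loc.rep.HasLevelTwoInertiaShape ι (p : 𝒪[loc.F]) loc.irreducible_natCast 0 1) :
    serreWeight p ρ loc ι = 2 :=
  serreWeightLocal_eq_two_of_hasLevelTwoInertiaShape_zero_one loc.rep ι loc.irreducible_natCast h

/-- **`k(ρ̄) = 2` in the tame case of (2.8.2)** at a local restriction datum (`p ≠ 2`):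
`ρ̄|I_p ≃ (χ *; 0 1)` with wild inertia acting trivially gives `serreWeight p ρ̄ loc ι = 2`.
[cite: Serre1987, §2.8 Prop. 3 (2.8.2)] -/
theorem serreWeight_eq_two_of_isTamelyRamified [DiscreteTopology k] (hp : p ≠ 2)
    (ht : loc.rep.IsTamelyRamified)
    (h : loc.rep.HasLevelOneInertiaShape ι (p : 𝒪[loc.F]) loc.irreducible_natCast 1 0) :
    serreWeight p ρ loc ι = 2 :=
  serreWeightLocal_eq_two_of_isTamelyRamified loc.rep ι (loc.residueFieldCard_eq.symm ▸ hp) ht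
    loc.irreducible_natCast h

/-- **`k(ρ̄) = 2` in the peu ramifiée case of (2.8.2)** at a local restriction datum:
`ρ̄|I_p ≃ (χ *; 0 1)`, wild and peu ramifiée, gives `serreWeight p ρ̄ loc ι = 2`.
[cite: Serre1987, §2.4 (ii₁); §2.8 Prop. 3 (2.8.2)] -/
theorem serreWeight_eq_two_of_isPeuRamifie [DiscreteTopology k] (hw : ¬ loc.rep.IsTamelyRamified)
    (hpeu : loc.rep.IsPeuRamifie)
    (h : loc.rep.HasLevelOneInertiaShape ι (p : 𝒪[loc.F]) loc.irreducible_natCast 1 0) :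
    serreWeight p ρ loc ι = 2 :=
  serreWeightLocal_eq_two_of_isPeuRamifie loc.rep ι hw hpeu loc.irreducible_natCast h

/-- **Serre 1987, §2.8 Prop. 3 at `p ≠ 2`, global form**: `k(ρ̄) = 2` whenever `ρ̄|I_p` has one of
the shapes (2.8.1), (2.8.2) (tame or peu ramifiée). [cite: Serre1987, §2.8 Prop. 3, p. 189] -/
theorem serreWeight_eq_two_of_shape [DiscreteTopology k] (hp : p ≠ 2)
    (h : loc.rep.HasLevelTwoInertiaShape ι (p : 𝒪[loc.F]) loc.irreducible_natCast 0 1 ∨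
      (loc.rep.HasLevelOneInertiaShape ι (p : 𝒪[loc.F]) loc.irreducible_natCast 1 0 ∧
        (loc.rep.IsTamelyRamified ∨ loc.rep.IsPeuRamifie))) :
    serreWeight p ρ loc ι = 2 :=
  serreWeightLocal_eq_two_of_shape loc.rep ι (loc.residueFieldCard_eq.symm ▸ hp)
    loc.irreducible_natCast h

end Global

end ModPGaloisRep
end Literature.NumberTheory.GaloisRepresentations
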